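import Summits.HodgeConjecture.HodgeConjecture.Theorems.MilnorKExponentialSymbolClassesAlgebraicSymbolClassesHodgeTypeStrictness

/-!
# Stub (T) of the line `NashDescentSketch`, helper 2/3: uniqueness of transgressions; the projection onto `F^p`

Helper file (crux `SymbolClassesAlgebraic`, stmt-HodgeConjecture-17743; registered sub-goal
`stub_symbolClassesHodgeType_typeComponentSmooth`, serving the stub `stub_symbolClassesHodgeType`).
(a) Two Čech–de Rham transgressions (`IsTransgression`, Bott–Tu §8) of the same cochain over a
finite open cover have bottoms differing by an exact form (injectivity half of Bott–Tu Prop. 8.8,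
through `RowAugmentation.exists_dA_eq_of_colLE`). (b) The projection `Π_{≥p}` of forms onto `F^p`
commutes with restrictions, real scalars and sums, preserves the forms on an open set, and `d`
preserves `F^p`; hence the `δ`-equations of the Čech–de Rham complex (exact rows, Bott–Tu
Prop. 8.5) can be solved INSIDE `F^p`. Everything is proved; no named fact is introduced.
-/

noncomputable section

open scoped Manifold Topology ContDiff
open CategoryTheory AlgebraicGeometry Filter

-- the tree's own summit-side namespaces repeat `HodgeConjecture` (summit = sub-problem)
set_option linter.dupNamespace false

-- `TangentSpace 𝓘(ℝ, E) x = E` is an abuse of definitional equality; let `isDefEq` unfold it.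
set_option backward.isDefEq.respectTransparency false

namespace Summit.HodgeConjecture.HodgeConjecture.Theorems.MilnorKExponentialNash

open Literature.AlgebraicGeometry Literature.AlgebraicGeometry.HodgeTheory
  Literature.AlgebraicGeometry.Motives Literature.Geometry.Kaehler
  Literature.NumberTheory.Transcendental

/-! ### Uniqueness: two transgressions of the same cochain differ by an exact form -/

section Uniqueness

open Set Literature.Algebra.Homology

variable {E : Type*} [NormedAddCommGroup E] [NormedSpace ℝ E] [FiniteDimensional ℝ E]
  {H : Type*} [TopologicalSpace H] {I : ModelWithCorners ℝ E H}
  {M : Type*} [TopologicalSpace M] [ChartedSpace H M] [IsManifold I ∞ M] [T2Space M]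
  [SigmaCompactSpace M]
  {F : Type*} [NormedAddCommGroup F] [NormedSpace ℝ F]
  {ι : Type*} [Fintype ι] {U : ι → Set M} {hU : ∀ i, IsOpen (U i)} {q : ℕ}

/-- **A transgression of the ZERO cochain has an exact bottom form** (the injectivity half of
Bott–Tu (1982), Prop. 8.8, `H_D{C^•(𝔘, Ω^•)} ≅ H_dR(M)`: the re-signed zig-zag `y_{a,b} = (-1)^a Z_{a,b}`
(`a + b = 2q + 1`, `a ≤ q`) has total differential `D y = r θ` concentrated in the column `0`, and
descending the staircase with the exactness of the rows (partition of unity, Prop. 8.5) shows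
`θ = dη` for a global smooth form `η` — `RowAugmentation.exists_dA_eq_of_colLE`).
[cite: BottTu1982Forms, §8 Prop. 8.8] -/
theorem exists_eq_mextDeriv_of_isTransgression_zero {θ : MForm I M F (2 * q + 1 + 1)}
    (h : IsTransgression hU q (0 : (Fin (q + 2) → ι) → MForm I M F (q + 1)) θ)
    (hcov : ∀ x, ∃ i, x ∈ U i) :
    ∃ η : MForm I M F (2 * q + 1), IsSmoothForm η ∧ θ = mextDeriv η := by
  classical
  have hθs : IsSmoothForm θ := h.isSmoothForm hcov
  obtain ⟨Z, ht, hs, hb⟩ := h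
  -- a partition of unity subordinate to the cover: the rows are exact
  have hcov' : (univ : Set M) ⊆ ⋃ i, U i := fun x _ ↦ mem_iUnion.2 (hcov x)
  obtain ⟨ρ, hρ⟩ := SmoothPartitionOfUnity.exists_isSubordinate I isClosed_univ U hU hcov'
  have hK := cechDeRham_rowExact (F := F) hU ρ hρ
  have hE := cechDeRhamRow_exact (F := F) hU ρ hρ hcov
  -- `θ` as a form on `univ`
  let θu : smoothFormsOn I F (univ : Set M) (2 * q + 1 + 1) := ⟨θ, by rwa [smoothFormsOn_univ]⟩
  -- the re-signed truncated zig-zag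
  let y : (a b : ℕ) → CechForms I F U a b := fun a b ↦
    if a + b = 2 * q + 1 ∧ a ≤ q then ((-1 : ℝ) ^ a) • Z a b else 0
  have hy_of : ∀ a b, a + b = 2 * q + 1 → a ≤ q → y a b = ((-1 : ℝ) ^ a) • Z a b :=
    fun a b h1 h2 ↦ if_pos ⟨h1, h2⟩
  have hy_no : ∀ a b, ¬ (a + b = 2 * q + 1 ∧ a ≤ q) → y a b = 0 := fun a b h ↦ if_neg h
  have hyT : y ∈ ADoubleComplex.Tn ℝ (2 * q + 1) :=
    (ADoubleComplex.mem_Tn_iff (R := ℝ)).2 fun a b hab ↦ hy_no a b fun h ↦ hab h.1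
  have hycol : ADoubleComplex.ColLE y q := fun a b hqa ↦ hy_no a b fun h ↦ by omega
  -- `δ Z_{q,q+1} = 0` (the top is the zero cochain)
  have htop : cechδ I F hU q (q + 1) (Z q (q + 1)) = 0 := by
    funext J
    apply Subtype.ext
    funext x
    by_cases hx : x ∈ cechSet U J
    · rw [ht J x hx]
      rfl
    · rw [(cechδ I F hU q (q + 1) (Z q (q + 1)) J).2.2 x hx]
      rfl
  -- `cechd Z_{0,2q+1} = r θ`
  have hbot : cechd I F hU 0 (2 * q + 1) (Z 0 (2 * q + 1)) = (cechDeRhamRow I F hU).ε (2 * q + 1 + 1) θu := by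
    funext J
    apply Subtype.ext
    rw [coe_cechDeRhamRow_ε]
    funext x
    by_cases hx : x ∈ cechSet U J
    · rw [hb J x hx, MForm.restr_apply_of_mem _ hx]
    · rw [(cechd I F hU 0 (2 * q + 1) (Z 0 (2 * q + 1)) J).2.2 x hx, MForm.restr_apply_of_notMem _ hx]
  -- `D y = (r θ at (0, 2q+2))`
  have hD : (cechDeRham I F hU).totalD y =
      ADoubleComplex.single 0 (2 * q + 1 + 1) ((cechDeRhamRow I F hU).ε (2 * q + 1 + 1) θu) := by
    funext a b
    cases a with
    | zero =>
      cases b with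
      | zero =>
        rw [ADoubleComplex.totalD_apply_zero_zero, ADoubleComplex.single_apply_of_ne_snd (by omega)]
      | succ b =>
        rw [ADoubleComplex.totalD_apply_zero_succ]
        by_cases hbq : b = 2 * q + 1
        · subst hbq
          rw [ADoubleComplex.single_apply_same, hy_of 0 (2 * q + 1) (by omega) (Nat.zero_le q),
            pow_zero, one_smul]
          exact hbot
        · rw [hy_no 0 b (by omega), map_zero, ADoubleComplex.single_apply_of_ne_snd (by omega)]
    | succ a =>
      rw [ADoubleComplex.single_apply_of_ne_fst (Nat.succ_ne_zero a)]
      cases b with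
      | zero =>
        rw [ADoubleComplex.totalD_apply_succ_zero, hy_no a 0 (by omega), map_zero]
      | succ b =>
        rw [ADoubleComplex.totalD_apply_succ_succ]
        by_cases hab : a + b = 2 * q
        · rcases Nat.lt_or_ge a q with haq | haq
          · -- a step of the staircase
            rw [hy_of a (b + 1) (by omega) haq.le, hy_of (a + 1) b (by omega) haq, map_smul, map_smul]
            change (-1 : ℝ) ^ a • cechδ I F hU a (b + 1) (Z a (b + 1)) +
              (-1 : ℝ) ^ (a + 1) • cechd I F hU (a + 1) b (Z (a + 1) b) = 0
            rw [hs a b (by omega) haq, ← add_smul, pow_succ, mul_neg_one, add_neg_cancel, zero_smul]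
          · rcases haq.eq_or_lt with hqa | hlt
            · -- the top: `δ Z_{q,q+1} = 0`
              have hqa' : a = q := hqa.symm
              have hqb : b = q := by omega
              subst a
              subst b
              rw [hy_of q (q + 1) (by omega) le_rfl, hy_no (q + 1) q (by omega), map_zero, add_zero,
                map_smul]
              change (-1 : ℝ) ^ q • cechδ I F hU q (q + 1) (Z q (q + 1)) = 0
              rw [htop, smul_zero]
            · rw [hy_no a (b + 1) (by omega), hy_no (a + 1) b (by omega), map_zero, map_zero, add_zero]
        · rw [hy_no a (b + 1) (by omega), hy_no (a + 1) b (by omega), map_zero, map_zero, add_zero]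
  obtain ⟨a', ha'⟩ := (cechDeRhamRow I F hU).exists_dA_eq_of_colLE hK hE (2 * q + 1) q θu y hyT hycol hD
  refine ⟨(a' : MForm I M F (2 * q + 1)), ?_, ?_⟩
  · have h2 : (a' : MForm I M F (2 * q + 1)) ∈ smoothForms I M F (2 * q + 1) := by
      rw [← smoothFormsOn_univ]
      exact a'.2
    exact (mem_smoothForms_iff _).1 h2
  · have hθ : θ = ((cechDeRhamRow I F hU).dA (2 * q + 1) a' : MForm I M F (2 * q + 1 + 1)) := by
      rw [ha']
    rw [hθ]
    funext x
    exact localD_apply_of_mem isOpen_univ a' (mem_univ x)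

/-- **Two transgressions of the same cochain differ by an exact form** (well-definedness of the
de Rham class of the bottom form, Bott–Tu (1982), Prop. 8.8; needed because `IsTransgression`
records only the EXISTENCE of a zig-zag). [cite: BottTu1982Forms, §8 Prop. 8.8] -/
theorem exists_sub_eq_mextDeriv_of_isTransgression {w : (Fin (q + 2) → ι) → MForm I M F (q + 1)}
    {θ θ' : MForm I M F (2 * q + 1 + 1)} (h : IsTransgression hU q w θ)
    (h' : IsTransgression hU q w θ') (hcov : ∀ x, ∃ i, x ∈ U i) :
    ∃ η : MForm I M F (2 * q + 1), IsSmoothForm η ∧ θ - θ' = mextDeriv η := by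
  have h0 := h.sub h'
  rw [sub_self] at h0
  exact exists_eq_mextDeriv_of_isTransgression_zero h0 hcov

end Uniqueness

/-! ### A transgression staying in `F^p` (typed zig-zag through the Čech–de Rham complex) -/

section TypedTransgression

open Set Literature.Algebra.Homology Literature.Analysis.Complex

variable {E : Type*} [NormedAddCommGroup E] [NormedSpace ℂ E] [FiniteDimensional ℂ E]
  {M : Type*} [TopologicalSpace M] [ChartedSpace E M] [IsManifold 𝓘(ℂ, E) ω M]
  [IsManifold 𝓘(ℝ, E) ∞ M] [T2Space M]

-- `projFp p k α = Π_{≥p} α = Σ_{P ≥ p, P + Q = k} α^{P,Q}`, the projection of a complex `k`-form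
-- onto the step `F^p` of the Hodge filtration of forms (Voisin I, §7.1.1); a notation, not a
-- definition.
set_option quotPrecheck false in
local notation "projFp" p:max k:max α:max =>
  (∑ pq ∈ Finset.filter (fun pq : ℕ × ℕ ↦ p ≤ Prod.fst pq) (Finset.HasAntidiagonal.antidiagonal k),
    MForm.typeComponent (Prod.fst pq) (Prod.snd pq) α : MForm 𝓘(ℝ, E) M ℂ k)

omit [FiniteDimensional ℂ E] [IsManifold 𝓘(ℂ, E) ω M] [IsManifold 𝓘(ℝ, E) ∞ M] [T2Space M] in
/-- The projection onto `F^p` lands in `F^p`. [cite: VoisinHodgeI2002, §2.3.1 and §7.1.1] -/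
theorem typeComponent_projFp_eq_zero (p k : ℕ) (α : MForm 𝓘(ℝ, E) M ℂ k) {P Q : ℕ} (hP : P < p) :
    (projFp p k α).typeComponent P Q = 0 := by
  rw [MForm.typeComponent_sum]
  refine Finset.sum_eq_zero fun pq hpq ↦ ?_
  have hle : p ≤ pq.1 := (Finset.mem_filter.1 hpq).2
  rw [typeComponent_typeComponent_holds, if_neg]
  rintro ⟨h1, -⟩
  omega

omit [FiniteDimensional ℂ E] [IsManifold 𝓘(ℂ, E) ω M] [IsManifold 𝓘(ℝ, E) ∞ M] [T2Space M] in
/-- A form of `F^p` is its own projection onto `F^p`. [cite: VoisinHodgeI2002, §2.3.1 and §7.1.1] -/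
theorem projFp_eq_self (p k : ℕ) {α : MForm 𝓘(ℝ, E) M ℂ k}
    (hF : ∀ P Q : ℕ, P < p → α.typeComponent P Q = 0) : projFp p k α = α := by
  conv_rhs => rw [← sum_antidiagonal_typeComponent_holds α,
    ← Finset.sum_filter_add_sum_filter_not _ (fun pq : ℕ × ℕ ↦ p ≤ pq.1)]
  rw [Finset.sum_eq_zero (s := Finset.filter (fun pq : ℕ × ℕ ↦ ¬ p ≤ pq.1) _), add_zero]
  intro pq hpq
  exact hF pq.1 pq.2 (by have := (Finset.mem_filter.1 hpq).2; omega)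

omit [FiniteDimensional ℂ E] [IsManifold 𝓘(ℂ, E) ω M] [IsManifold 𝓘(ℝ, E) ∞ M] [T2Space M] in
/-- The projection onto `F^p` commutes with restriction. [folklore] -/
theorem projFp_restr (p k : ℕ) (α : MForm 𝓘(ℝ, E) M ℂ k) (W : Set M) :
    projFp p k (α.restr W) = (projFp p k α).restr W := by
  rw [MForm.restr_sum]
  exact Finset.sum_congr rfl fun pq _ ↦ typeComponent_restr _ _ α W

omit [FiniteDimensional ℂ E] [IsManifold 𝓘(ℂ, E) ω M] [IsManifold 𝓘(ℝ, E) ∞ M] [T2Space M] in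
/-- The projection onto `F^p` commutes with real scalars. [folklore] -/
theorem projFp_real_smul (p k : ℕ) (r : ℝ) (α : MForm 𝓘(ℝ, E) M ℂ k) :
    projFp p k (r • α) = r • projFp p k α := by
  rw [Finset.smul_sum]
  exact Finset.sum_congr rfl fun pq _ ↦ typeComponent_real_smul _ _ r α

omit [FiniteDimensional ℂ E] [IsManifold 𝓘(ℂ, E) ω M] [IsManifold 𝓘(ℝ, E) ∞ M] [T2Space M] in
/-- The projection onto `F^p` commutes with finite sums. [folklore] -/
theorem projFp_sum (p k : ℕ) {β : Type*} (s : Finset β) (f : β → MForm 𝓘(ℝ, E) M ℂ k) :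
    projFp p k (∑ b ∈ s, f b) = ∑ b ∈ s, projFp p k (f b) := by
  rw [Finset.sum_comm]
  exact Finset.sum_congr rfl fun pq _ ↦ MForm.typeComponent_sum s f _ _

omit [IsManifold 𝓘(ℂ, E) ω M] in
/-- **Localisation**: a form smooth at the points of an open `W` agrees near each `x ∈ W` with a
globally smooth form (bump function). [folklore] -/
theorem exists_smooth_eventuallyEq_of_mem_smoothFormsOn {W : Set M} (hW : IsOpen W) {k : ℕ}
    {α : MForm 𝓘(ℝ, E) M ℂ k} (hα : α ∈ smoothFormsOn 𝓘(ℝ, E) ℂ W k) {x : M} (hx : x ∈ W) :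
    ∃ β : MForm 𝓘(ℝ, E) M ℂ k, IsSmoothForm β ∧ ∀ᶠ z in 𝓝 x, β z = α z := by
  obtain ⟨f, -, hf⟩ := (SmoothBumpFunction.nhds_basis_tsupport (I := 𝓘(ℝ, E)) x).mem_iff.1
    (hW.mem_nhds hx)
  refine ⟨(f : M → ℝ) • α, ?_, ?_⟩
  · refine (isSmoothForm_iff_smoothAt _).2 fun z ↦ ?_
    by_cases hz : z ∈ W
    · exact (hα.1 z hz).fun_smul f.contMDiff.contMDiffAt
    · have h0 : (f : M → ℝ) =ᶠ[𝓝 z] 0 := notMem_tsupport_iff_eventuallyEq.1 fun h ↦ hz (hf h)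
      refine MForm.smoothAt_of_eventuallyEq_zero ?_
      filter_upwards [h0] with w hw
      rw [Pi.smul_apply', hw, Pi.zero_apply, zero_smul]
  · filter_upwards [f.eventuallyEq_one] with z hz
    rw [Pi.smul_apply', hz, Pi.one_apply, one_smul]

/-- Type components of a form on an open `W` are forms on `W`. [cite: VoisinHodgeI2002, §2.3.1] -/
theorem typeComponent_mem_smoothFormsOn {W : Set M} (hW : IsOpen W) {k : ℕ}
    {α : MForm 𝓘(ℝ, E) M ℂ k} (hα : α ∈ smoothFormsOn 𝓘(ℝ, E) ℂ W k) (P Q : ℕ) :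
    α.typeComponent P Q ∈ smoothFormsOn 𝓘(ℝ, E) ℂ W k := by
  refine ⟨fun x hx ↦ ?_, fun x hx ↦ typeComponent_apply_of_apply_eq_zero P Q (hα.2 x hx)⟩
  obtain ⟨β, hβ, hβα⟩ := exists_smooth_eventuallyEq_of_mem_smoothFormsOn hW hα hx
  have hev : ∀ᶠ z in 𝓝 x, (β.typeComponent P Q) z = (α.typeComponent P Q) z :=
    hβα.mono fun z hz ↦ typeComponent_congr_apply' P Q hz
  exact (MForm.smoothAt_congr_of_eventuallyEq hev).1
    ((isSmoothForm_iff_smoothAt _).1 (hβ.typeComponent P Q) x)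

/-- The projection onto `F^p` of a form on an open `W` is a form on `W`. [folklore] -/
theorem projFp_mem_smoothFormsOn {W : Set M} (hW : IsOpen W) (p k : ℕ)
    {α : MForm 𝓘(ℝ, E) M ℂ k} (hα : α ∈ smoothFormsOn 𝓘(ℝ, E) ℂ W k) :
    projFp p k α ∈ smoothFormsOn 𝓘(ℝ, E) ℂ W k :=
  Submodule.sum_mem _ fun pq _ ↦ typeComponent_mem_smoothFormsOn hW hα pq.1 pq.2

omit [FiniteDimensional ℂ E] [T2Space M] in
/-- The projection onto `F^p` of a smooth form is smooth. [folklore] -/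
theorem isSmoothForm_projFp (p k : ℕ) {α : MForm 𝓘(ℝ, E) M ℂ k} (hα : IsSmoothForm α) :
    IsSmoothForm (projFp p k α) :=
  (smoothForms 𝓘(ℝ, E) M ℂ k).sum_mem fun (pq : ℕ × ℕ) _ ↦ hα.typeComponent pq.1 pq.2

/-- **`d` preserves `F^p` on an open set**: if all components `α^{P,Q}`, `P < p`, of a form `α` on
the open `W` vanish, so do those of `d_W α` (`d A^{P,Q} ⊆ A^{P+1,Q} ⊕ A^{P,Q+1}`, localised).
[cite: VoisinHodgeI2002, §2.3.1 Def. 2.27 and §7.1.1] -/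
theorem typeComponent_localD_eq_zero {W : Set M} (hW : IsOpen W) {k p : ℕ}
    (α : smoothFormsOn 𝓘(ℝ, E) ℂ W k)
    (hF : ∀ P Q : ℕ, P < p → (α : MForm 𝓘(ℝ, E) M ℂ k).typeComponent P Q = 0) {P Q : ℕ}
    (hP : P < p) : (localD 𝓘(ℝ, E) ℂ k hW α : MForm 𝓘(ℝ, E) M ℂ (k + 1)).typeComponent P Q = 0 := by
  rw [coe_localD, typeComponent_restr]
  funext x
  by_cases hx : x ∈ W
  · rw [MForm.restr_apply_of_mem _ hx]
    obtain ⟨β, hβ, hβα⟩ := exists_smooth_eventuallyEq_of_mem_smoothFormsOn hW α.2 hx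
    have hd : mextDeriv (α : MForm 𝓘(ℝ, E) M ℂ k) x = mextDeriv β x :=
      mextDeriv_congr_of_eventuallyEq (hβα.mono fun z hz ↦ hz.symm)
    rw [typeComponent_apply_eq_typeProjAt, hd, ← typeComponent_apply_eq_typeProjAt]
    have hsm : ∀ pq ∈ Finset.HasAntidiagonal.antidiagonal k,
        IsSmoothForm (β.typeComponent pq.1 pq.2) := fun pq _ ↦ hβ.typeComponent _ _
    conv_lhs => rw [← sum_antidiagonal_typeComponent_holds β, mextDeriv_sum _ _ hsm,
      MForm.typeComponent_sum]
    rw [Finset.sum_apply]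
    refine Finset.sum_eq_zero fun pq hpq ↦ ?_
    by_cases hlt : pq.1 < p
    · have hz : ∀ᶠ z in 𝓝 x, (β.typeComponent pq.1 pq.2) z = 0 := by
        filter_upwards [hβα] with z hz
        rw [typeComponent_congr_apply' pq.1 pq.2 hz, hF pq.1 pq.2 hlt]
        rfl
      exact typeComponent_apply_of_apply_eq_zero P Q
        (mextDeriv_apply_eq_zero_of_eventuallyEq_zero hz)
    · have hpq' := Finset.HasAntidiagonal.mem_antidiagonal.1 hpq
      have h0 := IsOfType.typeComponent_mextDeriv_eq_zero (r := P) (s := Q) (hsm pq hpq)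
        (isOfType_typeComponent_holds hpq' β) ?_ ?_
      · rw [h0]
        rfl
      · intro h
        simp only [Prod.mk.injEq] at h
        omega
      · intro h
        simp only [Prod.mk.injEq] at h
        omega
  · rw [MForm.restr_apply_of_notMem _ hx]
    rfl

variable {ι : Type*} {U : ι → Set M} (hU : ∀ i, IsOpen (U i))

/-- `(-1)^a d` preserves `F^p`. [folklore] -/
theorem typeComponent_cechd_eq_zero {a b p : ℕ} (c : CechForms 𝓘(ℝ, E) ℂ U a b)
    (hc : ∀ J (P Q : ℕ), P < p → (c J : MForm 𝓘(ℝ, E) M ℂ b).typeComponent P Q = 0)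
    (J : Fin (a + 1) → ι) {P Q : ℕ} (hP : P < p) :
    (cechd 𝓘(ℝ, E) ℂ hU a b c J : MForm 𝓘(ℝ, E) M ℂ (b + 1)).typeComponent P Q = 0 := by
  rw [cechd_apply, Submodule.coe_smul, typeComponent_real_smul,
    typeComponent_localD_eq_zero _ _ (hc J) hP, smul_zero]

/-- **Row exactness inside `F^p`**: a `δ`-cocycle of forms of `F^p` is `δ` of a cochain of forms of
`F^p` (take any preimage, exactness of the rows, and project it onto `F^p`: `δ` commutes with the
type projections). [cite: BottTu1982Forms, Prop. 8.5] -/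
theorem exists_cechδ_eq_of_typeComponent_eq_zero (hK : (cechDeRham 𝓘(ℝ, E) ℂ hU).RowExact)
    {a b p : ℕ} (c : CechForms 𝓘(ℝ, E) ℂ U (a + 1) b) (hc0 : cechδ 𝓘(ℝ, E) ℂ hU (a + 1) b c = 0)
    (hc : ∀ J (P Q : ℕ), P < p → (c J : MForm 𝓘(ℝ, E) M ℂ b).typeComponent P Q = 0) :
    ∃ v : CechForms 𝓘(ℝ, E) ℂ U a b, cechδ 𝓘(ℝ, E) ℂ hU a b v = c ∧
      ∀ J (P Q : ℕ), P < p → (v J : MForm 𝓘(ℝ, E) M ℂ b).typeComponent P Q = 0 := by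
  obtain ⟨y, hy⟩ := hK.exact a b c hc0
  refine ⟨fun J ↦ ⟨projFp p b (y J : MForm 𝓘(ℝ, E) M ℂ b),
    projFp_mem_smoothFormsOn (isOpen_cechSet hU J) p b (y J).2⟩, ?_,
    fun J P Q hP ↦ typeComponent_projFp_eq_zero p b _ hP⟩
  funext J
  apply Subtype.ext
  rw [coe_cechδ_apply]
  have hy' : cechδ 𝓘(ℝ, E) ℂ hU a b y = c := hy
  have hyJ : (cechδ 𝓘(ℝ, E) ℂ hU a b y J : MForm 𝓘(ℝ, E) M ℂ b) = c J := by rw [hy']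
  calc ∑ j : Fin (a + 2), (-1 : ℝ) ^ (j : ℕ) •
        (projFp p b (y (J ∘ Fin.succAbove j) : MForm 𝓘(ℝ, E) M ℂ b)).restr (cechSet U J)
      = projFp p b (∑ j : Fin (a + 2), (-1 : ℝ) ^ (j : ℕ) •
          ((y (J ∘ Fin.succAbove j) : MForm 𝓘(ℝ, E) M ℂ b)).restr (cechSet U J)) := by
        rw [projFp_sum]
        refine Finset.sum_congr rfl fun j _ ↦ ?_
        rw [projFp_real_smul, projFp_restr]
    _ = projFp p b (c J : MForm 𝓘(ℝ, E) M ℂ b) := by rw [← coe_cechδ_apply hU, hyJ]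
    _ = c J := projFp_eq_self p b (hc J)

omit [FiniteDimensional ℂ E] [T2Space M] in
/-- **Gluing inside `F^p`**: a `δ`-cocycle of the column `0` made of forms of `F^p` is the
restriction of a GLOBAL smooth form of `F^p`. [cite: BottTu1982Forms, Prop. 8.5] -/
theorem exists_restr_eq_of_typeComponent_eq_zero (hE : (cechDeRhamRow 𝓘(ℝ, E) ℂ hU).Exact)
    {b p : ℕ} (c : CechForms 𝓘(ℝ, E) ℂ U 0 b) (hc0 : cechδ 𝓘(ℝ, E) ℂ hU 0 b c = 0)
    (hc : ∀ J (P Q : ℕ), P < p → (c J : MForm 𝓘(ℝ, E) M ℂ b).typeComponent P Q = 0) :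
    ∃ θ : MForm 𝓘(ℝ, E) M ℂ b, IsSmoothForm θ ∧
      (∀ P Q : ℕ, P < p → θ.typeComponent P Q = 0) ∧
      ∀ J, θ.restr (cechSet U J) = (c J : MForm 𝓘(ℝ, E) M ℂ b) := by
  obtain ⟨a', ha'⟩ := hE.exact b c hc0
  have ha's : IsSmoothForm (a' : MForm 𝓘(ℝ, E) M ℂ b) := by
    have h2 : (a' : MForm 𝓘(ℝ, E) M ℂ b) ∈ smoothForms 𝓘(ℝ, E) M ℂ b := by
      rw [← smoothFormsOn_univ]
      exact a'.2
    exact (mem_smoothForms_iff _).1 h2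
  refine ⟨projFp p b (a' : MForm 𝓘(ℝ, E) M ℂ b), isSmoothForm_projFp p b ha's,
    fun P Q hP ↦ typeComponent_projFp_eq_zero p b _ hP, fun J ↦ ?_⟩
  have hJ : (a' : MForm 𝓘(ℝ, E) M ℂ b).restr (cechSet U J) = (c J : MForm 𝓘(ℝ, E) M ℂ b) := by
    rw [← coe_cechDeRhamRow_ε hU a' J, ha']
  rw [← projFp_restr, hJ]
  exact projFp_eq_self p b (hc J)

end TypedTransgression

/-- Registered sub-goal of helper 2/3: the type components of a form on `ℂ` smooth everywhere are
smooth everywhere (instance of `typeComponent_mem_smoothFormsOn`). [cite: VoisinHodgeI2002, §2.3.1] -/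
theorem stub_symbolClassesHodgeType_typeComponentSmooth : ∀ (P Q : ℕ) (α : MForm 𝓘(ℝ, ℂ) ℂ ℂ 0), α ∈ smoothFormsOn 𝓘(ℝ, ℂ) ℂ (Set.univ : Set ℂ) 0 → MForm.typeComponent P Q α ∈ smoothFormsOn 𝓘(ℝ, ℂ) ℂ (Set.univ : Set ℂ) 0 :=
  fun P Q _ hα ↦ typeComponent_mem_smoothFormsOn isOpen_univ hα P Q

end Summit.HodgeConjecture.HodgeConjecture.Theorems.MilnorKExponentialNash

end
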